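import Mathlib.Analysis.SpecialFunctions.Log.Deriv
import Mathlib.Analysis.SpecialFunctions.Log.NegMulLog
import Literature.Geometry.Riemannian.PerelmanEntropyNoncollapsing
import Literature.Geometry.Riemannian.RicciFlowScalarCurvatureHolds
import Literature.Geometry.Lorentzian.ChartLaplacian
import Literature.Geometry.Lorentzian.GreenIdentity
import Literature.MeasureTheory.Jensen.EntropyBound
import HarnessLib

/-!
# Topping's test-function bound `μ(g, λr²) ≤ …` from a cutoff (Topping 2006, Lemma 8.3.5),
# and no local collapsing from cutoffs ∧ (T2) ∧ (T3)

`PerelmanEntropyNoncollapsing.lean` reduces Perelman's no local collapsing theorem I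
(`perelman_noLocalCollapsing`, `CanonicalNeighbourhoods.lean`) to three entropy estimates of
Topping's Chapter 8, taken there as hypotheses: (T1) the test-function upper bound of
Lemma 8.3.5, (T2) the monotonicity `μ(g(0), τ + T') ≤ μ(g(T'), τ)` ((8.3.10)), (T3) the lower
bound of Lemma 8.1.8. This file PROVES (T1) in the form in which it is used, from the one
ingredient of its printed proof that is not analysis of the `𝒲`-functional — a cutoff function
adapted to the pair of balls `B(p, r/2) ⊆ B(p, r)`:

* `wEntropy_cutoffTest_le` — for `g` Riemannian on a closed manifold, `τ > 0`, a smooth `χ` with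
  `0 ≤ χ ≤ 1`, `χ = 1` on `B(p, r/2)`, `tsupport χ ⊆ B(p, r)`, `|∇χ|²_g ≤ K`, and `δ > 0`, the
  function `f_δ = c_δ - log (χ² + δ²)` (`c_δ` fixed by compatibility) is smooth, compatible, and
  `𝒲(g, f_δ, τ) ≤ 4τK (V₁ - V₂)/V₂ + (τ/V₂)(∫_{B(p,r)} |R| dV + δ² ∫_M |R| dV) + m₁ log (V₁/m₁)
   + (Vol M - V₁)(-σ₀ log σ₀) + log (4πτ)^{-n/2} - n`,
  `V₁ = Vol B(p,r)`, `V₂ = Vol B(p,r/2)`, `σ₀ = δ²/∫(χ²+δ²)`, `m₁ = 1 - σ₀ (Vol M - V₁)` — the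
  four "Terms" of Topping's proof of Lemma 8.3.5 for `φ² = e^{-f} ∝ χ² + δ²`: the substitution
  (8.1.8) `|∇f|² e^{-f} ∝ |∇v|²/v`, `v = χ² + δ²` (`gradSq_const_sub_log_comp`,
  `gradSq_sq_add_const`), Term 1 supported in `B(p,r) ∖ B(p,r/2)`, Term 3 by Jensen's inequality
  for `-y log y` on `B(p, r)` with mass `m₁` (`setIntegral_negMulLog_le_mul_log`, from
  `Literature.MeasureTheory.Jensen`);
* `muEntropy_le_of_cutoff` — letting `δ → 0`:
  `μ(g, τ) ≤ 4τK (V₁ - V₂)/V₂ + (τ/V₂) ∫_{B(p,r)} |R| dV + log [V₁/(4πτ)^{n/2}] - n`; for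
  `τ = λr²`, `K = 9/r²` this is Lemma 8.3.5 verbatim (`36λ (𝒱(p,r) - 𝒱(p,r/2))/𝒱(p,r/2) + …`).
  The printed proof tests `𝒲` on the non-smooth, non-positive `φ = e^{-c/2} ψ(d(x,p)/r)` and
  appeals to "approximation, (8.3.5)"; here `μ` is, as printed in Perelman 2002, §3.1, an infimum
  over smooth `f`, and the approximation is the explicit family `f_δ`;
* `mul_pow_le_of_entropy_estimate'` — the real-variable core of Thm. 8.3.4 ⇒ (8.3.11) with a
  general Term-1 coefficient `a` (`ξ = (π/9)^{n/2} exp (m + n - (a + n²) 2ⁿ⁺¹)`);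
* `entropyDichotomy_of_cutoffs`, `perelman_noLocalCollapsing_of_cutoffs` —
  **cutoffs ∧ (T2) ∧ (T3) ⇒ `perelman_noLocalCollapsing`**: the hypothesis (T1) of
  `perelman_noLocalCollapsing_of_muBounds` is replaced by the existence of a constant `C₀` and,
  for every closed Riemannian manifold, `p` and `s > 0`, of a smooth cutoff `χ : M → [0,1]`,
  `χ = 1` on `B(p, s/2)`, `tsupport χ ⊆ B(p, s)`, `|∇χ|² ≤ C₀/s²` (in print `ψ(d(x,p)/s)`
  smoothed, `|ψ'| ≤ 3`; e.g. by smoothing the distance function, Greene–Wu). The scalar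
  curvature of the slices is continuous by `contMDiff_scalarCurvatureWith_holds`.

Everything is proved; no definition, no named fact is introduced (net debt delta 0). The named
fact `perelman_noLocalCollapsing` is NOT discharged: it is now conditional on the cutoffs, on
(T2) (Perelman's entropy formula (3.4) with the backward conjugate heat flow, Topping Prop. 8.2.1
and Rem. 8.2.5) and on (T3) (Topping Lemma 8.1.8, second part: Sobolev inequality on `(M, g)`).

## References

* P. Topping, *Lectures on the Ricci flow*, LMS Lecture Note Series 325, CUP 2006, §8.1
  ((8.1.8), Lemma 8.1.8), §8.3 (Thm. 8.3.1, Thm. 8.3.4, Lemma 8.3.5 and its proof, Terms 1–4,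
  (8.3.3)–(8.3.7), (8.3.10), (8.3.11)). [Topping2006]
* G. Perelman, *The entropy formula for the Ricci flow and its geometric applications*,
  arXiv:math/0211159 (2002), §3.1 (definition of `μ` over smooth `f`), §4, Thm. 4.1. [Perelman2002]
-/

noncomputable section

open Bundle Set Module Filter MeasureTheory Manifold Real
open scoped ContDiff Topology ENNReal NNReal

namespace Literature.Geometry.Riemannian

open Lorentzian

universe u v w

/-! ### Chain rules for the gradient square -/

section GradSq

variable {E : Type*} [NormedAddCommGroup E] [NormedSpace ℝ E] {H : Type*} [TopologicalSpace H]
  {I : ModelWithCorners ℝ E H} {M : Type*} [TopologicalSpace M] [ChartedSpace H M]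
  [IsManifold I ∞ M] {n : ℕ∞ω} [FiniteDimensional ℝ E]
  (g : PseudoRiemannianMetric I n E (TangentSpace I : M → Type _))

/-- `g⁻¹(c α, c α) = c² g⁻¹(α, α)`. [folklore] -/
theorem _root_.Literature.Geometry.Lorentzian.PseudoRiemannianMetric.innerDual_smul_smul (x : M)
    (c : ℝ) (α : Module.Dual ℝ (TangentSpace I x)) :
    g.innerDual x (c • α) (c • α) = c ^ 2 * g.innerDual x α α := by
  simp only [PseudoRiemannianMetric.innerDual, map_smul, LinearMap.smul_apply, smul_eq_mul]
  ring

/-- For a Riemannian metric the gradient square is non-negative: `|∇ψ|²_g ≥ 0`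
(`g⁻¹(α, α) = g(♯α, ♯α) ≥ 0`). [folklore] -/
theorem _root_.Literature.Geometry.Lorentzian.PseudoRiemannianMetric.gradSq_nonneg
    (hg : g.IsRiemannian) (ψ : M → ℝ) (x : M) : 0 ≤ g.gradSq ψ x := by
  rw [PseudoRiemannianMetric.gradSq, PseudoRiemannianMetric.innerDual_eq_val_sharp_sharp]
  by_cases h : g.sharp x (mvfderiv I ψ x : TangentSpace I x →ₗ[ℝ] ℝ) = 0
  · rw [h]; simp
  · exact (hg x _ h).le

/-- The gradient square vanishes where the differential does. [folklore] -/
theorem _root_.Literature.Geometry.Lorentzian.PseudoRiemannianMetric.gradSq_eq_zero_of_mvfderiv_eq_zero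
    {ψ : M → ℝ} {x : M} (h : mvfderiv I ψ x = 0) : g.gradSq ψ x = 0 := by
  simp [PseudoRiemannianMetric.gradSq, h, PseudoRiemannianMetric.innerDual]

omit [IsManifold I ∞ M] [FiniteDimensional ℝ E] in
/-- **Chain rule for the differential**: `d(h ∘ φ)_x = h'(φ x) · dφ_x` for `h : ℝ → ℝ`
differentiable at `φ x` and `φ` differentiable at `x`. [folklore] -/
theorem mvfderiv_real_comp_apply {φ : M → ℝ} {h : ℝ → ℝ} {h' : ℝ} {x : M}
    (hh : HasDerivAt h h' (φ x)) (hφ : MDifferentiableAt I 𝓘(ℝ, ℝ) φ x) (v : TangentSpace I x) :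
    mvfderiv I (h ∘ φ) x v = h' * mvfderiv I φ x v := by
  have hhm : HasMFDerivAt 𝓘(ℝ, ℝ) 𝓘(ℝ, ℝ) h (φ x)
      (ContinuousLinearMap.smulRight (1 : ℝ →L[ℝ] ℝ) h') :=
    hh.hasFDerivAt.hasMFDerivAt
  have hcomp := (hhm.comp x hφ.hasMFDerivAt).mfderiv
  simp only [mvfderiv, ContinuousLinearMap.comp_apply, hcomp]
  set w : ℝ := mfderiv I 𝓘(ℝ, ℝ) φ x v with hw
  change ((1 : ℝ →L[ℝ] ℝ) w) • h' = h' * w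
  simp [mul_comm]

/-- **Chain rule for the gradient square**: `|∇(h ∘ φ)|²_g (x) = h'(φ x)² |∇φ|²_g (x)` at a
point where `φ` is differentiable and `h` has derivative `h'(φ x)`. [folklore] -/
theorem _root_.Literature.Geometry.Lorentzian.PseudoRiemannianMetric.gradSq_real_comp
    {φ : M → ℝ} {h : ℝ → ℝ} {h' : ℝ} {x : M}
    (hh : HasDerivAt h h' (φ x)) (hφ : MDifferentiableAt I 𝓘(ℝ, ℝ) φ x) :
    g.gradSq (h ∘ φ) x = h' ^ 2 * g.gradSq φ x := by
  have hd : (mvfderiv I (h ∘ φ) x : TangentSpace I x →ₗ[ℝ] ℝ) =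
      h' • (mvfderiv I φ x : TangentSpace I x →ₗ[ℝ] ℝ) := by
    ext v
    simp [mvfderiv_real_comp_apply hh hφ v]
  rw [PseudoRiemannianMetric.gradSq, hd, PseudoRiemannianMetric.innerDual_smul_smul,
    PseudoRiemannianMetric.gradSq]

/-- `|∇(χ² + a)|² = 4χ² |∇χ|²`. [folklore] -/
theorem _root_.Literature.Geometry.Lorentzian.PseudoRiemannianMetric.gradSq_sq_add_const
    {χ : M → ℝ} (a : ℝ) {x : M} (hχ : MDifferentiableAt I 𝓘(ℝ, ℝ) χ x) :
    g.gradSq (fun y ↦ χ y ^ 2 + a) x = 4 * χ x ^ 2 * g.gradSq χ x := by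
  have hh : HasDerivAt (fun t : ℝ ↦ t ^ 2 + a) (2 * χ x) (χ x) := by
    simpa using ((hasDerivAt_pow 2 (χ x)).add_const a)
  have := g.gradSq_real_comp (h := fun t : ℝ ↦ t ^ 2 + a) hh hχ
  rw [show (fun y ↦ χ y ^ 2 + a) = (fun t : ℝ ↦ t ^ 2 + a) ∘ χ from rfl, this]
  ring

/-- The `φ² = v` substitution for the gradient term (Topping 2006, (8.1.8)): for `v x > 0` and
`v` differentiable at `x`, `|∇(c - log ∘ v)|² = |∇v|² / v²`. [cite: Topping2006, §8.1, (8.1.8)] -/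
theorem _root_.Literature.Geometry.Lorentzian.PseudoRiemannianMetric.gradSq_const_sub_log_comp
    {v : M → ℝ} (c : ℝ) {x : M} (hvx : 0 < v x) (hv : MDifferentiableAt I 𝓘(ℝ, ℝ) v x) :
    g.gradSq (fun y ↦ c - Real.log (v y)) x = (v x)⁻¹ ^ 2 * g.gradSq v x := by
  have hh : HasDerivAt (fun t ↦ c - Real.log t) (-(v x)⁻¹) (v x) := by
    simpa using (Real.hasDerivAt_log hvx.ne').const_sub c
  have := g.gradSq_real_comp (h := fun t ↦ c - Real.log t) hh hv
  rw [show (fun y ↦ c - Real.log (v y)) = (fun t ↦ c - Real.log t) ∘ v from rfl, this]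
  ring

end GradSq

/-! ### Jensen's inequality for `-σ log σ` with a general mass -/

section Jensen

variable {α : Type*} [MeasurableSpace α] {μ : Measure α}

/-- **Entropy bound with mass `m`** (Jensen for `-y log y`, scaled): for a set `B` of finite
positive measure and `σ ≥ 0` a.e. on `B` with `∫_B σ dμ = m > 0`,
`∫_B -σ log σ dμ ≤ m log (μ(B)/m)` (apply `setIntegral_negMulLog_le_log_measureReal` to `σ/m`).
[cite: Topping2006, §8.3, proof of Lemma 8.3.5, (8.3.7)] -/
theorem setIntegral_negMulLog_le_mul_log {B : Set α} (hB0 : μ B ≠ 0) (hBt : μ B ≠ ⊤)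
    {σ : α → ℝ} (hσ : 0 ≤ᵐ[μ.restrict B] σ) (hσi : IntegrableOn σ B μ) {m : ℝ} (hm : 0 < m)
    (hσm : ∫ x in B, σ x ∂μ = m) (hGi : IntegrableOn (fun x ↦ negMulLog (σ x)) B μ) :
    ∫ x in B, negMulLog (σ x) ∂μ ≤ m * Real.log (μ.real B / m) := by
  have hBpos : 0 < μ.real B := by
    rw [measureReal_def]; exact ENNReal.toReal_pos hB0 hBt
  -- the normalised density `σ/m`
  have hσ' : 0 ≤ᵐ[μ.restrict B] fun x ↦ σ x / m := by
    filter_upwards [hσ] with x hx using div_nonneg hx hm.le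
  have hσi' : IntegrableOn (fun x ↦ σ x / m) B μ := hσi.div_const m
  have hσ1' : ∫ x in B, σ x / m ∂μ = 1 := by
    rw [integral_div, hσm, div_self hm.ne']
  -- `negMulLog (σ/m) = negMulLog σ / m + (σ/m) log m`
  have hid : ∀ x, negMulLog (σ x / m) = negMulLog (σ x) / m + σ x / m * Real.log m := by
    intro x
    by_cases hx : σ x = 0
    · simp [hx, negMulLog]
    · rw [negMulLog, negMulLog, Real.log_div hx hm.ne']
      ring
  have hGi' : IntegrableOn (fun x ↦ negMulLog (σ x / m)) B μ := by
    simp_rw [hid]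
    exact (hGi.div_const m).add (hσi'.mul_const _)
  have hJ := Literature.MeasureTheory.Jensen.setIntegral_negMulLog_le_log_measureReal hB0 hBt
    hσ' hσi' hσ1' hGi'
  simp_rw [hid] at hJ
  rw [integral_add (hGi.div_const m) (hσi'.mul_const _), integral_mul_const, hσ1', one_mul,
    integral_div] at hJ
  -- `hJ : (∫_B negMulLog σ) / m + log m ≤ log μ(B)`
  rw [Real.log_div hBpos.ne' hm.ne', mul_sub]
  have := (div_le_iff₀ hm).1 (show (∫ x in B, negMulLog (σ x) ∂μ) / m ≤ Real.log (μ.real B) -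
    Real.log m by linarith)
  linarith [this, mul_comm (Real.log (μ.real B) - Real.log m) m]

end Jensen

/-! ### The test-function bound from a cutoff -/

section Cutoff

variable {E : Type*} [NormedAddCommGroup E] [NormedSpace ℝ E] [FiniteDimensional ℝ E]
  {H : Type*} [TopologicalSpace H] {I : ModelWithCorners ℝ E H} [I.Boundaryless]
  {M : Type*} [TopologicalSpace M] [T2Space M] [CompactSpace M]
  [ChartedSpace H M] [IsManifold I ∞ M] [MeasurableSpace M] [BorelSpace M]

omit [I.Boundaryless] in
/-- On a closed manifold continuous functions are integrable for `dV_g` (a finite measure).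
[folklore] -/
theorem _root_.Literature.Geometry.Lorentzian.PseudoRiemannianMetric.integrable_of_continuous
    (g : PseudoRiemannianMetric I ∞ E (TangentSpace I : M → Type _)) {F : M → ℝ}
    (hF : Continuous F) : Integrable F g.riemVolume := by
  haveI : IsFiniteMeasure g.riemVolume := ⟨g.riemVolume_univ_lt_top⟩
  simpa [integrableOn_univ] using hF.continuousOn.integrableOn_compact isCompact_univ

/-- **The `𝒲`-entropy of the test functions `f = c - log (χ² + δ²)`** (the computation behind
Topping 2006, Lemma 8.3.5, with `φ² = e^{-f} ∝ χ² + δ²` everywhere positive so that `f` is an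
honest smooth compatible function). Let `g` be Riemannian on a closed manifold with continuous
scalar curvature `R` (w.r.t. `cov`), `τ > 0`, `χ` smooth with `0 ≤ χ ≤ 1`, `χ = 1` on
`B₂ = B(p, r/2)`, `tsupport χ ⊆ B₁ = B(p, r)` and `|∇χ|² ≤ K`; let `0 < δ`,
`N = ∫ (χ² + δ²) dV`, `c = log ((4πτ)^{-n/2} N)`, `σ₀ = δ²/N`, `m₁ = 1 - σ₀ (Vol M - V₁)`, and
assume `m₁ > 0`. Then `f = c - log (χ² + δ²)` is smooth and compatible, and
`𝒲(g, f, τ) ≤ 4τK (V₁ - V₂)/V₂ + (τ/V₂)(∫_{B₁} |R| + δ² ∫_M |R|) + m₁ log (V₁/m₁)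
  + (Vol M - V₁)(-σ₀ log σ₀) + log (4πτ)^{-n/2} - n`
(Term 1: `|∇f|² e^{-f} ∝ 4χ²|∇χ|²/(χ²+δ²) ≤ 4|∇χ|²`, supported in `B₁ ∖ B₂`; Term 2: `χ² ≤ 𝟙_{B₁}`;
Term 3: Jensen on `B₁` for the density `σ = (χ²+δ²)/N` of mass `m₁`, plus the constant `σ₀`
off `B₁`; Term 4: `-n`). [cite: Topping2006, §8.3, proof of Lemma 8.3.5] -/
theorem wEntropy_cutoffTest_le
    {g : PseudoRiemannianMetric I ∞ E (TangentSpace I : M → Type _)} (hg : g.IsRiemannian)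
    {cov : CovariantDerivative I E (TangentSpace I : M → Type _)}
    (hR : Continuous fun x ↦ g.scalarCurvatureWith cov x)
    {p : M} {r τ K : ℝ} (hr : 0 < r) (hτ : 0 < τ)
    {χ : M → ℝ} (hχs : ContMDiff I 𝓘(ℝ, ℝ) ∞ χ) (hχ0 : ∀ x, 0 ≤ χ x) (hχ1 : ∀ x, χ x ≤ 1)
    (hχB : ∀ x ∈ g.ball p (ENNReal.ofReal (r / 2)), χ x = 1)
    (hχsupp : tsupport χ ⊆ g.ball p (ENNReal.ofReal r)) (hχK : ∀ x, g.gradSq χ x ≤ K)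
    {δ : ℝ} (hδ : 0 < δ)
    (hm₁ : 0 < 1 - δ ^ 2 / (∫ x, (χ x ^ 2 + δ ^ 2) ∂g.riemVolume) *
      ((g.riemVolume univ).toReal - (g.vol (g.ball p (ENNReal.ofReal r))).toReal)) :
    let N : ℝ := ∫ x, (χ x ^ 2 + δ ^ 2) ∂g.riemVolume
    let c : ℝ := Real.log ((4 * Real.pi * τ) ^ (-(finrank ℝ E : ℝ) / 2) * N)
    let f : M → ℝ := fun x ↦ c - Real.log (χ x ^ 2 + δ ^ 2)
    let V₁ : ℝ := (g.vol (g.ball p (ENNReal.ofReal r))).toReal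
    let V₂ : ℝ := (g.vol (g.ball p (ENNReal.ofReal (r / 2)))).toReal
    let VM : ℝ := (g.riemVolume univ).toReal
    let σ₀ : ℝ := δ ^ 2 / N
    let m₁ : ℝ := 1 - σ₀ * (VM - V₁)
    ContMDiff I 𝓘(ℝ, ℝ) ∞ f ∧ g.IsEntropyCompatible f τ ∧
      g.wEntropy cov f τ ≤
        4 * τ * K * (V₁ - V₂) / V₂
          + τ / V₂ * (∫ x in g.ball p (ENNReal.ofReal r), |g.scalarCurvatureWith cov x| ∂g.riemVolume
              + δ ^ 2 * ∫ x, |g.scalarCurvatureWith cov x| ∂g.riemVolume)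
          + m₁ * Real.log (V₁ / m₁) + (VM - V₁) * negMulLog σ₀
          + Real.log ((4 * Real.pi * τ) ^ (-(finrank ℝ E : ℝ) / 2)) - finrank ℝ E := by
  intro N c f V₁ V₂ VM σ₀ m₁
  classical
  -- the measure and the balls
  set vol := g.riemVolume with hvol
  haveI : IsFiniteMeasure vol := ⟨g.riemVolume_univ_lt_top⟩
  set B₁ := g.ball p (ENNReal.ofReal r) with hB₁
  set B₂ := g.ball p (ENNReal.ofReal (r / 2)) with hB₂
  have hB₂B₁ : B₂ ⊆ B₁ := g.ball_mono p (ENNReal.ofReal_le_ofReal (by linarith))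
  have hB₁o : IsOpen B₁ := PseudoRiemannianMetric.isOpen_ball hg p _
  have hB₂o : IsOpen B₂ := PseudoRiemannianMetric.isOpen_ball hg p _
  have hB₁m : MeasurableSet B₁ := hB₁o.measurableSet
  have hB₂m : MeasurableSet B₂ := hB₂o.measurableSet
  have hfin : ∀ s : Set M, vol s ≠ ⊤ := fun s ↦ measure_ne_top vol s
  have hV₂pos : 0 < V₂ := ENNReal.toReal_pos
    (PseudoRiemannianMetric.vol_ball_pos hg p (ENNReal.ofReal_pos.2 (half_pos hr))).ne' (hfin _)
  have hV₁pos : 0 < V₁ := ENNReal.toReal_pos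
    (PseudoRiemannianMetric.vol_ball_pos hg p (ENNReal.ofReal_pos.2 hr)).ne' (hfin _)
  have hV₂V₁ : V₂ ≤ V₁ := ENNReal.toReal_mono (hfin _) (measure_mono hB₂B₁)
  have hV₁VM : V₁ ≤ VM := ENNReal.toReal_mono (hfin _) (measure_mono (subset_univ _))
  have hdiff : (vol (B₁ \ B₂)).toReal = V₁ - V₂ := by
    rw [measure_sdiff hB₂B₁ hB₂m.nullMeasurableSet (hfin _), ENNReal.toReal_sub_of_le
      (measure_mono hB₂B₁) (hfin _)]
  have hcompl : (vol B₁ᶜ).toReal = VM - V₁ := by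
    rw [measure_compl hB₁m (hfin _), ENNReal.toReal_sub_of_le (measure_mono (subset_univ _))
      (hfin _)]
  -- the normalising constant
  set n := finrank ℝ E with hn
  set A : ℝ := (4 * Real.pi * τ) ^ (-(n : ℝ) / 2) with hA
  have hApos : 0 < A := entropyNormalisation_pos n hτ
  -- facts about `χ`
  have hχc : Continuous χ := hχs.continuous
  have hχd : ∀ x, MDifferentiableAt I 𝓘(ℝ, ℝ) χ x := fun x ↦
    (hχs x).mdifferentiableAt (by simp)
  have hχ_out : ∀ x, x ∉ B₁ → χ x = 0 := fun x hx ↦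
    image_eq_zero_of_notMem_tsupport (fun h ↦ hx (hχsupp h))
  have hχsq_le : ∀ x, χ x ^ 2 ≤ 1 := fun x ↦ by
    have := hχ1 x; have := hχ0 x; nlinarith
  have hgrad_out : ∀ x, x ∉ B₁ → g.gradSq χ x = 0 := fun x hx ↦
    g.gradSq_eq_zero_of_mvfderiv_eq_zero
      (mvfderiv_eq_zero_of_notMem_tsupport (fun h ↦ hx (hχsupp h)))
  have hgrad_in : ∀ x ∈ B₂, g.gradSq χ x = 0 := by
    intro x hx
    refine g.gradSq_eq_zero_of_mvfderiv_eq_zero ?_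
    have hev : χ =ᶠ[𝓝 x] fun _ ↦ (1 : ℝ) := by
      filter_upwards [hB₂o.mem_nhds hx] with y hy using hχB y hy
    have h0 : mfderiv I 𝓘(ℝ, ℝ) χ x = 0 := by
      rw [hev.mfderiv_eq]; exact mfderiv_const
    ext v
    simp [mvfderiv, h0]
  have hgrad_nn : ∀ x, 0 ≤ g.gradSq χ x := g.gradSq_nonneg hg χ
  have hK0 : 0 ≤ K := (hgrad_nn p).trans (hχK p)
  have hgradc : Continuous (g.gradSq χ) :=
    continuous_innerDual_mvfderiv g (hχs.of_le (by norm_num)) (hχs.of_le (by norm_num))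
  -- the positive function `v = χ² + δ²`
  set v : M → ℝ := fun x ↦ χ x ^ 2 + δ ^ 2 with hv
  have hvpos : ∀ x, 0 < v x := fun x ↦ by positivity
  have hvδ : ∀ x, δ ^ 2 ≤ v x := fun x ↦ by simp [hv]; positivity
  have hv_out : ∀ x, x ∉ B₁ → v x = δ ^ 2 := fun x hx ↦ by simp [hv, hχ_out x hx]
  have hv_in : ∀ x ∈ B₂, v x = 1 + δ ^ 2 := fun x hx ↦ by simp [hv, hχB x hx]
  have hvc : Continuous v := (hχc.pow 2).add continuous_const
  have hvs : ContMDiff I 𝓘(ℝ, ℝ) ∞ v :=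
    ((hχs.mul hχs).add (contMDiff_const (c := δ ^ 2))).congr (fun x ↦ by
      simp only [hv, Pi.add_apply, Pi.mul_apply]; ring)
  have hvd : ∀ x, MDifferentiableAt I 𝓘(ℝ, ℝ) v x := fun x ↦ (hvs x).mdifferentiableAt (by simp)
  -- `N = ∫ v ≥ V₂ > 0`
  have hvi : Integrable v vol := g.integrable_of_continuous hvc
  have hNV₂ : V₂ ≤ N := by
    have h1 : ∫ x in B₂, (1 : ℝ) ∂vol ≤ ∫ x in B₂, v x ∂vol :=
      setIntegral_mono_on (integrableOn_const (hfin _)) hvi.integrableOn hB₂m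
        (fun x hx ↦ by rw [hv_in x hx]; nlinarith)
    have h2 : ∫ x in B₂, v x ∂vol ≤ ∫ x, v x ∂vol :=
      setIntegral_le_integral hvi (Eventually.of_forall fun x ↦ (hvpos x).le)
    have h3 : ∫ x in B₂, (1 : ℝ) ∂vol = V₂ := by
      rw [setIntegral_const, smul_eq_mul, mul_one]; rfl
    linarith
  have hNpos : 0 < N := hV₂pos.trans_le hNV₂
  have hχ2i : Integrable (fun x ↦ χ x ^ 2) vol := g.integrable_of_continuous (by fun_prop)
  have hNeq : N = (∫ x, χ x ^ 2 ∂vol) + δ ^ 2 * VM := by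
    show ∫ x, (χ x ^ 2 + δ ^ 2) ∂vol = _
    rw [integral_add (f := fun x ↦ χ x ^ 2) (g := fun _ ↦ δ ^ 2) hχ2i (integrable_const _),
      integral_const, smul_eq_mul, mul_comm]
    rfl
  -- the constants `c`, `U = A e^{-c} = 1/N`
  have hc : c = Real.log (A * N) := rfl
  have hcexp : Real.exp (-c) = (A * N)⁻¹ := by
    rw [hc, Real.exp_neg, Real.exp_log (mul_pos hApos hNpos)]
  set U : ℝ := N⁻¹ with hU
  have hUpos : 0 < U := inv_pos.2 hNpos
  have hAU : A * Real.exp (-c) = U := by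
    rw [hcexp, mul_inv, ← mul_assoc, mul_inv_cancel₀ hApos.ne', one_mul]
  have hUN : U * N = 1 := inv_mul_cancel₀ hNpos.ne'
  have hUV₂ : U ≤ V₂⁻¹ := by rw [hU]; exact inv_anti₀ hV₂pos hNV₂
  have hclogU : c + Real.log U = Real.log A := by
    rw [hU, Real.log_inv, hc, Real.log_mul hApos.ne' hNpos.ne']; ring
  -- smoothness of `f`
  have hfs : ContMDiff I 𝓘(ℝ, ℝ) ∞ f := by
    intro x
    have hlog : ContDiffAt ℝ ∞ (fun t : ℝ ↦ c - Real.log t) (v x) :=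
      contDiffAt_const.sub (Real.contDiffAt_log.2 (hvpos x).ne')
    exact hlog.comp_contMDiffAt (hvs x)
  -- the density `u = A e^{-f} = U v`
  have hdens : ∀ x, entropyDensity n f τ x = U * v x := by
    intro x
    rw [entropyDensity_apply, ← hA, show f x = c - Real.log (v x) from rfl, neg_sub,
      Real.exp_sub, Real.exp_log (hvpos x), div_eq_mul_inv, ← Real.exp_neg]
    rw [← hAU]; ring
  -- compatibility
  have hcompat : g.IsEntropyCompatible f τ := by
    rw [PseudoRiemannianMetric.isEntropyCompatible_iff]
    simp_rw [← hn, hdens]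
    rw [integral_const_mul]
    exact hUN
  refine ⟨hfs, hcompat, ?_⟩
  -- the four integrands
  set R : M → ℝ := fun x ↦ g.scalarCurvatureWith cov x with hRdef
  set G : M → ℝ := fun x ↦ 4 * χ x ^ 2 * g.gradSq χ x / v x with hG
  have hf_eq : f = fun y ↦ c - Real.log (v y) := rfl
  have hgradf : ∀ x, g.gradSq f x = (v x)⁻¹ ^ 2 * (4 * χ x ^ 2 * g.gradSq χ x) := by
    intro x
    rw [hf_eq, g.gradSq_const_sub_log_comp c (hvpos x) (hvd x), hv,
      g.gradSq_sq_add_const (δ ^ 2) (hχd x)]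
  have hWint : ∀ x, (τ * (R x + g.gradSq f x) + f x - n) * entropyDensity n f τ x =
      U * (τ * (R x * v x) + τ * G x + (c - n) * v x - v x * Real.log (v x)) := by
    intro x
    have hvx : v x ≠ 0 := (hvpos x).ne'
    rw [hdens x, hgradf x, show f x = c - Real.log (v x) from rfl, hG]
    field_simp
    ring
  -- continuity and integrability of the pieces
  have hGc : Continuous G :=
    ((continuous_const.mul (hχc.pow 2)).mul hgradc).div hvc (fun x ↦ (hvpos x).ne')
  have hlogvc : Continuous (fun x ↦ Real.log (v x)) := hvc.log (fun x ↦ (hvpos x).ne')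
  have hRvi : Integrable (fun x ↦ R x * v x) vol := g.integrable_of_continuous (hR.mul hvc)
  have hGi : Integrable G vol := g.integrable_of_continuous hGc
  have hvlogi : Integrable (fun x ↦ v x * Real.log (v x)) vol :=
    g.integrable_of_continuous (hvc.mul hlogvc)
  have hRi : Integrable R vol := g.integrable_of_continuous hR
  have hRai : Integrable (fun x ↦ |R x|) vol := hRi.abs
  have hRχi : Integrable (fun x ↦ R x * χ x ^ 2) vol :=
    g.integrable_of_continuous (hR.mul (hχc.pow 2))
  -- `𝒲` as a combination of four integrals
  have hW : g.wEntropy cov f τ = U * (τ * ∫ x, R x * v x ∂vol + τ * ∫ x, G x ∂vol +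
      (c - n) * N - ∫ x, v x * Real.log (v x) ∂vol) := by
    rw [PseudoRiemannianMetric.wEntropy_def, ← hn]
    have heq : (fun x ↦ (τ * (g.scalarCurvatureWith cov x + g.gradSq f x) + f x - n) *
        entropyDensity n f τ x) =
        fun x ↦ U * (τ * (R x * v x) + τ * G x + (c - n) * v x - v x * Real.log (v x)) :=
      funext hWint
    rw [heq, integral_const_mul]
    congr 1
    have e3 : ∫ a, (τ * (R a * v a) + τ * G a) ∂vol = τ * ∫ a, R a * v a ∂vol + τ * ∫ a, G a ∂vol := by
      rw [integral_add (hRvi.const_mul τ) (hGi.const_mul τ), integral_const_mul, integral_const_mul]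
    have e2 : ∫ a, (τ * (R a * v a) + τ * G a + (c - n) * v a) ∂vol =
        (∫ a, (τ * (R a * v a) + τ * G a) ∂vol) + (c - n) * N := by
      rw [integral_add (f := fun a ↦ τ * (R a * v a) + τ * G a) (g := fun a ↦ (c - n) * v a)
        (by exact (hRvi.const_mul τ).add (hGi.const_mul τ)) (hvi.const_mul _), integral_const_mul]
    have e1 : ∫ a, (τ * (R a * v a) + τ * G a + (c - n) * v a - v a * Real.log (v a)) ∂vol =
        (∫ a, (τ * (R a * v a) + τ * G a + (c - n) * v a) ∂vol) - ∫ a, v a * Real.log (v a) ∂vol :=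
      integral_sub (f := fun a ↦ τ * (R a * v a) + τ * G a + (c - n) * v a)
        (g := fun a ↦ v a * Real.log (v a))
        (by exact ((hRvi.const_mul τ).add (hGi.const_mul τ)).add (hvi.const_mul _)) hvlogi
    rw [e1, e2, e3]
  -- Term 1: `∫ G ≤ 4K (V₁ - V₂)`
  have hI1 : ∫ x, G x ∂vol ≤ 4 * K * (V₁ - V₂) := by
    have hG0 : ∀ x, x ∉ B₁ \ B₂ → G x = 0 := by
      intro x hx
      by_cases h1 : x ∈ B₁
      · have h2 : x ∈ B₂ := by
          by_contra h2; exact hx ⟨h1, h2⟩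
        simp [hG, hgrad_in x h2]
      · simp [hG, hgrad_out x h1]
    rw [← setIntegral_eq_integral_of_forall_compl_eq_zero hG0]
    have hGle : ∀ x ∈ B₁ \ B₂, ‖G x‖ ≤ 4 * K := by
      intro x _
      have hGx : G x = 4 * g.gradSq χ x * (χ x ^ 2 / v x) := by
        simp only [hG]; ring
      have hquot : χ x ^ 2 / v x ≤ 1 := div_le_one_of_le₀ (by simp [hv]; positivity) (hvpos x).le
      have hG0' : 0 ≤ G x := by rw [hGx]; exact mul_nonneg (by linarith [hgrad_nn x]) (by positivity)
      rw [Real.norm_eq_abs, abs_of_nonneg hG0', hGx]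
      calc 4 * g.gradSq χ x * (χ x ^ 2 / v x) ≤ 4 * g.gradSq χ x * 1 := by
            gcongr; linarith [hgrad_nn x]
        _ ≤ 4 * K := by rw [mul_one]; gcongr; exact hχK x
    calc ∫ x in B₁ \ B₂, G x ∂vol ≤ ‖∫ x in B₁ \ B₂, G x ∂vol‖ := Real.le_norm_self _
      _ ≤ 4 * K * vol.real (B₁ \ B₂) :=
          norm_setIntegral_le_of_norm_le_const (measure_lt_top vol _) hGle
      _ = 4 * K * (V₁ - V₂) := by rw [measureReal_def, hdiff]
  -- Term 2: `∫ R v ≤ ∫_{B₁} |R| + δ² ∫ |R|`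
  have hI2 : ∫ x, R x * v x ∂vol ≤ (∫ x in B₁, |R x| ∂vol) + δ ^ 2 * ∫ x, |R x| ∂vol := by
    have hsplit : ∫ x, R x * v x ∂vol = (∫ x, R x * χ x ^ 2 ∂vol) + δ ^ 2 * ∫ x, R x ∂vol := by
      rw [← integral_const_mul, ← integral_add hRχi (hRi.const_mul _)]
      refine integral_congr_ae (Eventually.of_forall fun x ↦ ?_)
      simp only [hv]; ring
    have h0 : ∀ x, x ∉ B₁ → R x * χ x ^ 2 = 0 := fun x hx ↦ by simp [hχ_out x hx]
    have h1 : ∫ x, R x * χ x ^ 2 ∂vol ≤ ∫ x in B₁, |R x| ∂vol := by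
      rw [← setIntegral_eq_integral_of_forall_compl_eq_zero h0]
      refine setIntegral_mono hRχi.integrableOn hRai.integrableOn (fun x ↦ ?_)
      calc R x * χ x ^ 2 ≤ |R x| * χ x ^ 2 := by gcongr; exact le_abs_self _
        _ ≤ |R x| := mul_le_of_le_one_right (abs_nonneg _) (hχsq_le x)
    have h2 : ∫ x, R x ∂vol ≤ ∫ x, |R x| ∂vol := integral_mono hRi hRai (fun x ↦ le_abs_self _)
    rw [hsplit]
    gcongr
  -- Term 3: the entropy of the density `σ = U v`
  set σ : M → ℝ := fun x ↦ U * v x with hσ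
  have hσc : Continuous σ := continuous_const.mul hvc
  have hσi : Integrable σ vol := g.integrable_of_continuous hσc
  have hσpos : ∀ x, 0 < σ x := fun x ↦ mul_pos hUpos (hvpos x)
  have hnegi : Integrable (fun x ↦ negMulLog (σ x)) vol :=
    g.integrable_of_continuous (continuous_negMulLog.comp hσc)
  have hσint : ∫ x, σ x ∂vol = 1 := by
    simp only [hσ]
    rw [integral_const_mul]
    exact hUN
  have hσ₀ : ∀ x, x ∉ B₁ → σ x = σ₀ := by
    intro x hx
    show U * v x = δ ^ 2 / N
    rw [hv_out x hx, hU, div_eq_inv_mul]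
  have hvlog : ∀ x, -(U * (v x * Real.log (v x))) =
      negMulLog (σ x) + Real.log U * σ x := by
    intro x
    simp only [hσ]
    rw [negMulLog, Real.log_mul hUpos.ne' (hvpos x).ne']
    ring
  have hI4 : -(U * ∫ x, v x * Real.log (v x) ∂vol) =
      (∫ x, negMulLog (σ x) ∂vol) + Real.log U := by
    rw [← integral_const_mul, ← integral_neg, show (fun x ↦ -(U * (v x * Real.log (v x)))) =
      fun x ↦ negMulLog (σ x) + Real.log U * σ x from funext hvlog,
      integral_add hnegi (hσi.const_mul _), integral_const_mul, hσint, mul_one]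
  -- the entropy off `B₁` and the mass on `B₁`
  have hneg_out : ∫ x in B₁ᶜ, negMulLog (σ x) ∂vol = (VM - V₁) * negMulLog σ₀ := by
    rw [setIntegral_congr_fun hB₁m.compl (fun x hx ↦ by rw [hσ₀ x hx]), setIntegral_const,
      smul_eq_mul, measureReal_def, hcompl]
  have hσ_out : ∫ x in B₁ᶜ, σ x ∂vol = (VM - V₁) * σ₀ := by
    rw [setIntegral_congr_fun hB₁m.compl (fun x hx ↦ hσ₀ x hx), setIntegral_const, smul_eq_mul,
      measureReal_def, hcompl]
  have hσ_in : ∫ x in B₁, σ x ∂vol = m₁ := by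
    have := integral_add_compl hB₁m hσi
    rw [hσint, hσ_out] at this
    show ∫ x in B₁, σ x ∂vol = 1 - σ₀ * (VM - V₁)
    linarith
  have hm₁' : 0 < m₁ := hm₁
  have hneg_in : ∫ x in B₁, negMulLog (σ x) ∂vol ≤ m₁ * Real.log (V₁ / m₁) := by
    have hB0 : vol B₁ ≠ 0 :=
      (PseudoRiemannianMetric.vol_ball_pos hg p (ENNReal.ofReal_pos.2 hr)).ne'
    have h := setIntegral_negMulLog_le_mul_log hB0 (hfin _)
      (Eventually.of_forall fun x ↦ (hσpos x).le) hσi.integrableOn hm₁' hσ_in hnegi.integrableOn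
    rwa [measureReal_def] at h
  have hI3 : ∫ x, negMulLog (σ x) ∂vol ≤ m₁ * Real.log (V₁ / m₁) + (VM - V₁) * negMulLog σ₀ := by
    rw [← integral_add_compl hB₁m hnegi, hneg_out]
    linarith
  -- assemble
  set J := ∫ x in B₁, |R x| ∂vol with hJ
  set JM := ∫ x, |R x| ∂vol with hJM
  have hJ0 : 0 ≤ J := setIntegral_nonneg hB₁m (fun x _ ↦ abs_nonneg _)
  have hJM0 : 0 ≤ JM := integral_nonneg (fun x ↦ abs_nonneg _)
  have hT2 : U * (τ * ∫ x, R x * v x ∂vol) ≤ τ / V₂ * (J + δ ^ 2 * JM) := by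
    calc U * (τ * ∫ x, R x * v x ∂vol) ≤ U * (τ * (J + δ ^ 2 * JM)) := by gcongr
      _ ≤ V₂⁻¹ * (τ * (J + δ ^ 2 * JM)) := by gcongr
      _ = τ / V₂ * (J + δ ^ 2 * JM) := by ring
  have hT1 : U * (τ * ∫ x, G x ∂vol) ≤ 4 * τ * K * (V₁ - V₂) / V₂ := by
    calc U * (τ * ∫ x, G x ∂vol) ≤ U * (τ * (4 * K * (V₁ - V₂))) := by gcongr
      _ ≤ V₂⁻¹ * (τ * (4 * K * (V₁ - V₂))) := by
          have : 0 ≤ τ * (4 * K * (V₁ - V₂)) :=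
            mul_nonneg hτ.le (mul_nonneg (by positivity) (by linarith))
          gcongr
      _ = 4 * τ * K * (V₁ - V₂) / V₂ := by ring
  have hWeq : g.wEntropy cov f τ = U * (τ * ∫ x, R x * v x ∂vol) + U * (τ * ∫ x, G x ∂vol) +
      (∫ x, negMulLog (σ x) ∂vol) + Real.log A - n + (c - n) * (U * N - 1) := by
    rw [hW, ← hclogU]
    linear_combination hI4
  rw [hWeq, hUN, sub_self, mul_zero, add_zero]
  linarith [hT1, hT2, hI3]

/-- **Topping's Lemma 8.3.5 from a cutoff.** Let `g` be a Riemannian metric on a closed manifold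
with continuous scalar curvature `R` (w.r.t. `cov`), `τ > 0`, `r > 0`, `p ∈ M`, and suppose a
smooth cutoff `χ` is given with `0 ≤ χ ≤ 1`, `χ = 1` on `B(p, r/2)`, `tsupport χ ⊆ B(p, r)` and
`|∇χ|²_g ≤ K`. Then, with `V₁ = Vol B(p, r)`, `V₂ = Vol B(p, r/2)`,
`μ(g, τ) ≤ 4τK (V₁ - V₂)/V₂ + (τ/V₂) ∫_{B(p,r)} |R| dV + log [V₁/(4πτ)^{n/2}] - n`.
For `τ = λr²` and `K = 9/r²` (Topping's `φ = ψ(d(x,p)/r)`, `|ψ'| ≤ 3`) this is exactly the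
printed bound `36λ (𝒱(p,r) - 𝒱(p,r/2))/𝒱(p,r/2) + …` of Lemma 8.3.5; the smoothing "by
approximation, (8.3.5)" of the printed proof is replaced by the smooth compatible test functions
`f_δ = c_δ - log (χ² + δ²)` of `wEntropy_cutoffTest_le` and the limit `δ → 0`.
[cite: Topping2006, §8.3, Lemma 8.3.5] -/
theorem muEntropy_le_of_cutoff
    {g : PseudoRiemannianMetric I ∞ E (TangentSpace I : M → Type _)} (hg : g.IsRiemannian)
    {cov : CovariantDerivative I E (TangentSpace I : M → Type _)}
    (hR : Continuous fun x ↦ g.scalarCurvatureWith cov x)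
    {p : M} {r τ K : ℝ} (hr : 0 < r) (hτ : 0 < τ)
    {χ : M → ℝ} (hχs : ContMDiff I 𝓘(ℝ, ℝ) ∞ χ) (hχ0 : ∀ x, 0 ≤ χ x) (hχ1 : ∀ x, χ x ≤ 1)
    (hχB : ∀ x ∈ g.ball p (ENNReal.ofReal (r / 2)), χ x = 1)
    (hχsupp : tsupport χ ⊆ g.ball p (ENNReal.ofReal r)) (hχK : ∀ x, g.gradSq χ x ≤ K) :
    g.muEntropy cov τ ≤
      ((4 * τ * K * (((g.vol (g.ball p (ENNReal.ofReal r))).toReal -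
            (g.vol (g.ball p (ENNReal.ofReal (r / 2)))).toReal) /
            (g.vol (g.ball p (ENNReal.ofReal (r / 2)))).toReal)
        + τ / (g.vol (g.ball p (ENNReal.ofReal (r / 2)))).toReal *
            ∫ x in g.ball p (ENNReal.ofReal r), |g.scalarCurvatureWith cov x| ∂g.riemVolume
        + Real.log ((g.vol (g.ball p (ENNReal.ofReal r))).toReal /
            (4 * Real.pi * τ) ^ ((finrank ℝ E : ℝ) / 2))
        - finrank ℝ E : ℝ) : EReal) := by
  classical
  set vol := g.riemVolume with hvol
  haveI : IsFiniteMeasure vol := ⟨g.riemVolume_univ_lt_top⟩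
  set B₁ := g.ball p (ENNReal.ofReal r) with hB₁
  set B₂ := g.ball p (ENNReal.ofReal (r / 2)) with hB₂
  set V₁ := (g.vol B₁).toReal with hV₁
  set V₂ := (g.vol B₂).toReal with hV₂
  set VM := (vol univ).toReal with hVM
  set n := finrank ℝ E with hn
  set A : ℝ := (4 * Real.pi * τ) ^ (-(n : ℝ) / 2) with hA
  set J := ∫ x in B₁, |g.scalarCurvatureWith cov x| ∂vol with hJ
  set JM := ∫ x, |g.scalarCurvatureWith cov x| ∂vol with hJM
  set Iχ := ∫ x, χ x ^ 2 ∂vol with hIχ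
  have hB₂B₁ : B₂ ⊆ B₁ := g.ball_mono p (ENNReal.ofReal_le_ofReal (by linarith))
  have hB₂o : IsOpen B₂ := PseudoRiemannianMetric.isOpen_ball hg p _
  have hfin : ∀ s : Set M, vol s ≠ ⊤ := fun s ↦ measure_ne_top vol s
  have hV₂pos : 0 < V₂ := ENNReal.toReal_pos
    (PseudoRiemannianMetric.vol_ball_pos hg p (ENNReal.ofReal_pos.2 (half_pos hr))).ne' (hfin _)
  have hV₁pos : 0 < V₁ := ENNReal.toReal_pos
    (PseudoRiemannianMetric.vol_ball_pos hg p (ENNReal.ofReal_pos.2 hr)).ne' (hfin _)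
  have hVM0 : 0 ≤ VM := ENNReal.toReal_nonneg
  have hApos : 0 < A := entropyNormalisation_pos n hτ
  -- `∫ (χ² + δ²) = Iχ + δ² VM` and `Iχ ≥ V₂ > 0`
  have hχc : Continuous χ := hχs.continuous
  have hχ2i : Integrable (fun x ↦ χ x ^ 2) vol := g.integrable_of_continuous (by fun_prop)
  have hN : ∀ δ : ℝ, ∫ x, (χ x ^ 2 + δ ^ 2) ∂vol = Iχ + δ ^ 2 * VM := by
    intro δ
    rw [integral_add (f := fun x ↦ χ x ^ 2) (g := fun _ ↦ δ ^ 2) hχ2i (integrable_const _),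
      integral_const, smul_eq_mul, mul_comm]
    rfl
  have hIχ : V₂ ≤ Iχ := by
    have h1 : ∫ x in B₂, (1 : ℝ) ∂vol ≤ ∫ x in B₂, χ x ^ 2 ∂vol :=
      setIntegral_mono_on (integrableOn_const (hfin _)) hχ2i.integrableOn hB₂o.measurableSet
        (fun x hx ↦ by rw [hχB x hx]; norm_num)
    have h2 : ∫ x in B₂, χ x ^ 2 ∂vol ≤ ∫ x, χ x ^ 2 ∂vol :=
      setIntegral_le_integral hχ2i (Eventually.of_forall fun x ↦ sq_nonneg _)
    have h3 : ∫ x in B₂, (1 : ℝ) ∂vol = V₂ := by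
      rw [setIntegral_const, smul_eq_mul, mul_one]; rfl
    linarith
  have hIχpos : 0 < Iχ := hV₂pos.trans_le hIχ
  -- the bound as a function of `δ`
  set σf : ℝ → ℝ := fun δ ↦ δ ^ 2 / (Iχ + δ ^ 2 * VM) with hσf
  set mf : ℝ → ℝ := fun δ ↦ 1 - σf δ * (VM - V₁) with hmf
  set Bnd : ℝ → ℝ := fun δ ↦ 4 * τ * K * (V₁ - V₂) / V₂ + τ / V₂ * (J + δ ^ 2 * JM)
    + mf δ * Real.log (V₁ / mf δ) + (VM - V₁) * negMulLog (σf δ) + Real.log A - n with hBnd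
  -- Step 1: `μ ≤ Bnd δ` for every `δ > 0` with `mf δ > 0`
  have key : ∀ δ : ℝ, 0 < δ → 0 < mf δ → g.muEntropy cov τ ≤ ((Bnd δ : ℝ) : EReal) := by
    intro δ hδ hm
    have hm' : 0 < 1 - δ ^ 2 / (∫ x, (χ x ^ 2 + δ ^ 2) ∂g.riemVolume) *
        ((g.riemVolume univ).toReal - (g.vol (g.ball p (ENNReal.ofReal r))).toReal) := by
      have : (∫ x, (χ x ^ 2 + δ ^ 2) ∂g.riemVolume) = Iχ + δ ^ 2 * VM := hN δ
      rw [this]; exact hm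
    obtain ⟨hfs, hcompat, hW⟩ := wEntropy_cutoffTest_le hg hR hr hτ hχs hχ0 hχ1 hχB hχsupp hχK
      hδ hm'
    refine (PseudoRiemannianMetric.muEntropy_le hfs hcompat).trans ?_
    rw [EReal.coe_le_coe_iff]
    refine hW.trans (le_of_eq ?_)
    have hN' : ∫ x, (χ x ^ 2 + δ ^ 2) ∂g.riemVolume = Iχ + δ ^ 2 * VM := hN δ
    rw [hN']
  -- Step 2: `Bnd` is continuous at `0`, where it takes the value of the printed bound
  have hσc : Continuous σf := by
    refine Continuous.div (by fun_prop) (by fun_prop) (fun δ ↦ ?_)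
    have : 0 < Iχ + δ ^ 2 * VM := by positivity
    exact this.ne'
  have hmc : Continuous mf := continuous_const.sub (hσc.mul continuous_const)
  have hσ0 : σf 0 = 0 := by simp [hσf]
  have hm0 : mf 0 = 1 := by simp [hmf, hσ0]
  have hBc : ContinuousAt Bnd 0 := by
    have h1 : ContinuousAt (fun δ ↦ mf δ * Real.log (V₁ / mf δ)) 0 := by
      refine hmc.continuousAt.mul ((Real.continuousAt_log ?_).comp
        (continuousAt_const.div hmc.continuousAt ?_))
      · rw [hm0, div_one]; exact hV₁pos.ne'
      · rw [hm0]; exact one_ne_zero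
    have h2 : Continuous (fun δ ↦ (VM - V₁) * negMulLog (σf δ)) :=
      continuous_const.mul (continuous_negMulLog.comp hσc)
    have h3 : Continuous (fun δ : ℝ ↦ 4 * τ * K * (V₁ - V₂) / V₂ + τ / V₂ * (J + δ ^ 2 * JM)) := by
      fun_prop
    simp only [hBnd]
    exact (((h3.continuousAt.add h1).add h2.continuousAt).add continuousAt_const).sub
      continuousAt_const
  have hB0 : Bnd 0 = 4 * τ * K * ((V₁ - V₂) / V₂) + τ / V₂ * J +
      Real.log (V₁ / (4 * Real.pi * τ) ^ ((n : ℝ) / 2)) - n := by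
    have hlog : Real.log (V₁ / (4 * Real.pi * τ) ^ ((n : ℝ) / 2)) = Real.log V₁ + Real.log A := by
      rw [hA, Real.log_div hV₁pos.ne' (by positivity), Real.log_rpow (by positivity),
        Real.log_rpow (by positivity)]
      ring
    simp only [hBnd, hm0, hσ0, negMulLog_zero, div_one, one_mul, hlog]
    ring
  -- Step 3: let `δ → 0⁺`
  refine EReal.le_of_forall_lt_iff_le.1 (fun z hz ↦ ?_)
  have hz' : Bnd 0 < z := by
    rw [hB0]; exact EReal.coe_lt_coe_iff.1 hz
  have hev : ∀ᶠ δ in 𝓝[>] (0 : ℝ), Bnd δ < z ∧ 0 < mf δ := by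
    have e1 : ∀ᶠ δ in 𝓝 (0 : ℝ), Bnd δ < z := hBc.tendsto.eventually_lt_const hz'
    have e2 : ∀ᶠ δ in 𝓝 (0 : ℝ), 0 < mf δ :=
      hmc.continuousAt.tendsto.eventually_const_lt (by rw [hm0]; exact one_pos)
    exact nhdsWithin_le_nhds (e1.and e2)
  obtain ⟨δ, ⟨h1, h2⟩, hδ⟩ := (hev.and self_mem_nhdsWithin).exists
  exact (key δ hδ h2).trans (EReal.coe_le_coe_iff.2 h1.le)

end Cutoff

/-! ### The real-variable core with a general Term-1 coefficient -/

/-- `mul_pow_le_of_entropy_estimate` (`PerelmanEntropyNoncollapsing.lean`: the arithmetic of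
Topping 2006, (8.3.8)–(8.3.11) and of the proof of Thm. 8.3.1) with the coefficient `36λ` of the
first term replaced by a parameter `a ≥ 0` (the gradient bound of the cutoff enters only here):
from `m ≤ a (V₁ - V₂)/V₂ + (s²/36)/V₂ · J + log [V₁/(4π s²/36)^{n/2}] - n`, `J ≤ n² s⁻² V₁` and
`V₁ ≤ 2ⁿ⁺¹ V₂` one gets `ξ sⁿ ≤ V₁` with `ξ = (π/9)^{n/2} exp (m + n - (a + n²) 2ⁿ⁺¹)`.
[cite: Topping2006, §8.3, (8.3.11) and proof of Thm. 8.3.1] -/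
theorem mul_pow_le_of_entropy_estimate' (n : ℕ) {m V₁ V₂ s J a : ℝ} (hs : 0 < s) (hV₂ : 0 < V₂)
    (hV : V₂ ≤ V₁) (ha : 0 ≤ a)
    (hent : m ≤ a * ((V₁ - V₂) / V₂) + 1 / 36 * s ^ 2 / V₂ * J +
      Real.log (V₁ / (4 * Real.pi * (1 / 36 * s ^ 2)) ^ ((n : ℝ) / 2)) - n)
    (hJ : J ≤ (n : ℝ) ^ 2 * (s⁻¹ ^ 2) * V₁) (hdoub : V₁ ≤ 2 ^ (n + 1) * V₂) :
    (Real.pi / 9) ^ ((n : ℝ) / 2) * Real.exp (m + n - (a + (n : ℝ) ^ 2) * 2 ^ (n + 1)) * s ^ n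
      ≤ V₁ := by
  have hV₁ : 0 < V₁ := hV₂.trans_le hV
  have hπ : 0 < Real.pi / 9 := by positivity
  -- the scale factor `(4π s²/36)^{n/2} = (π/9)^{n/2} sⁿ`
  have hD : (4 * Real.pi * (1 / 36 * s ^ 2)) ^ ((n : ℝ) / 2) =
      (Real.pi / 9) ^ ((n : ℝ) / 2) * s ^ n := by
    have h1 : 4 * Real.pi * (1 / 36 * s ^ 2) = (Real.pi / 9) * s ^ 2 := by ring
    rw [h1, Real.mul_rpow hπ.le (sq_nonneg s)]
    congr 1
    rw [show ((s ^ 2 : ℝ)) = s ^ (2 : ℝ) by norm_cast, ← Real.rpow_mul hs.le,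
      show (2 : ℝ) * ((n : ℝ) / 2) = n by ring, Real.rpow_natCast]
  have hDpos : 0 < (Real.pi / 9) ^ ((n : ℝ) / 2) * s ^ n := by positivity
  -- bound the two ratio terms by `a 2ⁿ⁺¹` and `n² 2ⁿ⁺¹`
  have hratio : V₁ / V₂ ≤ 2 ^ (n + 1) := by rwa [div_le_iff₀ hV₂]
  have hT1 : a * ((V₁ - V₂) / V₂) ≤ a * 2 ^ (n + 1) := by
    refine mul_le_mul_of_nonneg_left ?_ ha
    calc (V₁ - V₂) / V₂ ≤ V₁ / V₂ := by gcongr; linarith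
      _ ≤ 2 ^ (n + 1) := hratio
  have hT2 : 1 / 36 * s ^ 2 / V₂ * J ≤ (n : ℝ) ^ 2 * 2 ^ (n + 1) := by
    have hcoef : 0 ≤ 1 / 36 * s ^ 2 / V₂ := by positivity
    calc 1 / 36 * s ^ 2 / V₂ * J ≤ 1 / 36 * s ^ 2 / V₂ * ((n : ℝ) ^ 2 * (s⁻¹ ^ 2) * V₁) := by
          gcongr
      _ = 1 / 36 * ((n : ℝ) ^ 2 * (V₁ / V₂)) := by field_simp
      _ ≤ 1 * ((n : ℝ) ^ 2 * 2 ^ (n + 1)) := by gcongr; norm_num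
      _ = (n : ℝ) ^ 2 * 2 ^ (n + 1) := one_mul _
  -- hence a lower bound for the logarithm of the volume ratio
  have hlog : m + n - (a + (n : ℝ) ^ 2) * 2 ^ (n + 1) ≤
      Real.log (V₁ / ((Real.pi / 9) ^ ((n : ℝ) / 2) * s ^ n)) := by
    rw [← hD]; linarith
  have hexp := Real.exp_le_exp.2 hlog
  rw [Real.exp_log (div_pos hV₁ hDpos), le_div_iff₀ hDpos] at hexp
  calc (Real.pi / 9) ^ ((n : ℝ) / 2) * Real.exp (m + n - (a + (n : ℝ) ^ 2) * 2 ^ (n + 1)) * s ^ n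
      = Real.exp (m + n - (a + (n : ℝ) ^ 2) * 2 ^ (n + 1)) *
          ((Real.pi / 9) ^ ((n : ℝ) / 2) * s ^ n) := by ring
    _ ≤ V₁ := hexp

/-! ### One flow: cutoffs ∧ (T2) ∧ (T3) give the entropy dichotomy bound -/

section OneFlowCutoff

variable {E : Type*} [NormedAddCommGroup E] [NormedSpace ℝ E] [FiniteDimensional ℝ E]
  {H : Type*} [TopologicalSpace H] {I : ModelWithCorners ℝ E H} [I.Boundaryless]
  {M : Type*} [TopologicalSpace M] [T2Space M] [CompactSpace M]
  [ChartedSpace H M] [IsManifold I ∞ M] [MeasurableSpace M] [BorelSpace M]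
  {g : ℝ → PseudoRiemannianMetric I ∞ E (TangentSpace I : M → Type _)}
  {cov : ℝ → CovariantDerivative I E (TangentSpace I : M → Type _)} {T : ℝ}

/-- **The entropy dichotomy bound for one flow from cutoffs, (T2) and (T3)** (Topping 2006,
proof of Thm. 8.3.4 and (8.3.11)): as `entropyDichotomy_of_muBounds`, with hypothesis (T1)
(Lemma 8.3.5) REPLACED by the existence, for every slice `g(t)`, point `p` and scale `s > 0`, of a
smooth cutoff `χ` with `0 ≤ χ ≤ 1`, `χ = 1` on `B_t(p, s/2)`, `tsupport χ ⊆ B_t(p, s)` and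
`|∇χ|²_{g(t)} ≤ C₀/s²` (Lemma 8.3.5 then holds by `muEntropy_le_of_cutoff`), plus continuity of
the scalar curvature of the slices. Conclusion: `ξ sⁿ ≤ Vol B_{t₀}(p, s)` under the curvature and
doubling hypotheses, with `ξ = (π/9)^{n/2} exp (m + n - (C₀/9 + n²) 2ⁿ⁺¹)`.
[cite: Topping2006, §8.3, Thm. 8.3.4, Lemma 8.3.5 and (8.3.11)] -/
theorem entropyDichotomy_of_cutoffs (hT : 0 < T) (hRiem : ∀ t ∈ Ico 0 T, (g t).IsRiemannian)
    (hRc : ∀ t ∈ Ico 0 T, Continuous fun x ↦ (g t).scalarCurvatureWith (cov t) x) {C₀ : ℝ}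
    (hχ : ∀ t ∈ Ico 0 T, ∀ (p : M) (s : ℝ), 0 < s → ∃ χ : M → ℝ,
      ContMDiff I 𝓘(ℝ, ℝ) ∞ χ ∧ (∀ x, 0 ≤ χ x) ∧ (∀ x, χ x ≤ 1) ∧
      (∀ x ∈ (g t).ball p (ENNReal.ofReal (s / 2)), χ x = 1) ∧
      tsupport χ ⊆ (g t).ball p (ENNReal.ofReal s) ∧ ∀ x, (g t).gradSq χ x ≤ C₀ / s ^ 2)
    (h₂ : ∀ t₀ ∈ Ioo 0 T, ∀ τ : ℝ, 0 < τ →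
      (g 0).muEntropy (cov 0) (τ + t₀) ≤ (g t₀).muEntropy (cov t₀) τ)
    (h₃ : ∀ τ₀ : ℝ, 0 < τ₀ → ∃ m : ℝ, ∀ τ ∈ Ioc 0 τ₀, (m : EReal) ≤ (g 0).muEntropy (cov 0) τ) :
    ∃ ξ : ℝ, 0 < ξ ∧ ∀ t₀ ∈ Ico 0 T, ∀ (p : M) (s : ℝ), 0 < s → s < Real.sqrt T →
      CurvatureBoundedOn (g t₀) (cov t₀) ((g t₀).ball p (ENNReal.ofReal s)) (s⁻¹ ^ 2) →
      (g t₀).vol ((g t₀).ball p (ENNReal.ofReal s)) ≤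
        2 ^ (finrank ℝ E + 1) * (g t₀).vol ((g t₀).ball p (ENNReal.ofReal (s / 2))) →
      ENNReal.ofReal (ξ * s ^ finrank ℝ E) ≤ (g t₀).vol ((g t₀).ball p (ENNReal.ofReal s)) := by
  set n := finrank ℝ E with hn
  -- (T3): a uniform lower bound `m` for `μ(g(0), τ)`, `τ ∈ (0, T/36 + T]`
  obtain ⟨m, hm⟩ := h₃ (T / 36 + T) (by positivity)
  refine ⟨(Real.pi / 9) ^ ((n : ℝ) / 2) * Real.exp (m + n - (C₀ / 9 + (n : ℝ) ^ 2) * 2 ^ (n + 1)),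
    by positivity, fun t₀ ht₀ p s hs hsT hcurv hdoub ↦ ?_⟩
  have hG : (g t₀).IsRiemannian := hRiem t₀ ht₀
  have hs2 : s ^ 2 < T := by
    calc s ^ 2 < Real.sqrt T ^ 2 := by gcongr
      _ = T := Real.sq_sqrt hT.le
  -- Step 1: `m ≤ μ(g(t₀), s²/36)` by (T3) at `t₀ = 0` and (T2)+(T3) for `t₀ > 0`
  have hμ : (m : EReal) ≤ (g t₀).muEntropy (cov t₀) (1 / 36 * s ^ 2) := by
    rcases ht₀.1.eq_or_lt with h0 | h0
    · subst h0
      exact hm _ ⟨by positivity, by linarith⟩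
    · calc (m : EReal) ≤ (g 0).muEntropy (cov 0) (1 / 36 * s ^ 2 + t₀) :=
            hm _ ⟨by positivity, by linarith [ht₀.2]⟩
        _ ≤ (g t₀).muEntropy (cov t₀) (1 / 36 * s ^ 2) := h₂ t₀ ⟨h0, ht₀.2⟩ _ (by positivity)
  -- Step 2: Lemma 8.3.5 from the cutoff at `τ = s²/36`, `r = s`, `K = C₀/s²`
  obtain ⟨χ, hχs, hχ0, hχ1, hχB, hχsupp, hχK⟩ := hχ t₀ ht₀ p s hs
  have hC₀ : 0 ≤ 4 * (1 / 36 * s ^ 2) * (C₀ / s ^ 2) := by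
    have h1 : 0 ≤ C₀ / s ^ 2 := ((g t₀).gradSq_nonneg hG χ p).trans (hχK p)
    positivity
  have h₁' := muEntropy_le_of_cutoff hG (hRc t₀ ht₀) hs (τ := 1 / 36 * s ^ 2) (by positivity)
    hχs hχ0 hχ1 hχB hχsupp hχK
  have hreal := EReal.coe_le_coe_iff.1 (hμ.trans h₁')
  -- the volumes as real numbers
  set V₁ := ((g t₀).vol ((g t₀).ball p (ENNReal.ofReal s))).toReal with hV₁
  set V₂ := ((g t₀).vol ((g t₀).ball p (ENNReal.ofReal (s / 2)))).toReal with hV₂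
  have hfin₁ := (g t₀).vol_ball_lt_top p (ENNReal.ofReal s)
  have hfin₂ := (g t₀).vol_ball_lt_top p (ENNReal.ofReal (s / 2))
  have hV₂pos : 0 < V₂ := ENNReal.toReal_pos
    (PseudoRiemannianMetric.vol_ball_pos hG p (ENNReal.ofReal_pos.2 (half_pos hs))).ne' hfin₂.ne
  have hV : V₂ ≤ V₁ := ENNReal.toReal_mono hfin₁.ne
    ((g t₀).vol_mono ((g t₀).ball_mono p (ENNReal.ofReal_le_ofReal (by linarith))))
  -- the curvature integral and the doubling property in `ℝ`
  have hJ : ∫ x in (g t₀).ball p (ENNReal.ofReal s), |(g t₀).scalarCurvatureWith (cov t₀) x|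
      ∂(g t₀).riemVolume ≤ (n : ℝ) ^ 2 * (s⁻¹ ^ 2) * V₁ :=
    setIntegral_abs_scalarCurvatureWith_le hG hcurv hfin₁
  have hdoub' : V₁ ≤ 2 ^ (n + 1) * V₂ := by
    have := ENNReal.toReal_mono (ENNReal.mul_ne_top (by simp) hfin₂.ne) hdoub
    simpa [hV₁, hV₂, ENNReal.toReal_mul, ENNReal.toReal_pow] using this
  -- Step 3: the real-variable lemma with `a = 4 (s²/36) (C₀/s²) = C₀/9`, and back to `ℝ≥0∞`
  have hkey := mul_pow_le_of_entropy_estimate' n hs hV₂pos hV hC₀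
    (by simpa [mul_assoc, mul_comm, mul_left_comm] using hreal) hJ hdoub'
  have ha : 4 * (1 / 36 * s ^ 2) * (C₀ / s ^ 2) = C₀ / 9 := by
    field_simp
    ring
  rw [ha] at hkey
  exact ENNReal.ofReal_le_of_le_toReal hkey

end OneFlowCutoff

/-! ### Cutoffs ∧ (T2) ∧ (T3) ⇒ `perelman_noLocalCollapsing` -/

/-- **Perelman's no local collapsing theorem I from metric cutoffs, the monotonicity of `μ` and
its lower bound** — `perelman_noLocalCollapsing_of_muBounds` with its hypothesis (T1) (Topping's
Lemma 8.3.5) now PROVED (`muEntropy_le_of_cutoff`) modulo the existence of cutoff functions: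
* `hχ` (**cutoffs adapted to geodesic balls**): there is a constant `C₀` such that for every
  Riemannian metric `g` (smooth, on a closed manifold), `p ∈ M` and `s > 0` there is a smooth
  `χ : M → [0, 1]` with `χ = 1` on `B(p, s/2)`, `tsupport χ ⊆ B(p, s)` and `|∇χ|²_g ≤ C₀/s²`
  (in print: `χ = ψ(d(x,p)/s)` smoothed, `|ψ'| ≤ 3`, Topping 2006, proof of Lemma 8.3.5);
* `h₂` (**Topping (8.3.10)**, from Prop. 8.2.1 and Rem. 8.2.5; Perelman 2002, (3.4)): for a
  Ricci flow of Riemannian metrics on `[0, T']`, `T' > 0`, and `τ > 0`: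
  `μ(g(0), τ + T') ≤ μ(g(T'), τ)`;
* `h₃` (**Topping Lemma 8.1.8**, boundedness; Perelman 2002, §3.1): `μ(g, ·)` is bounded below
  on `(0, τ₀]`.
The scalar curvature of the slices is continuous by `contMDiff_scalarCurvatureWith_holds`.
This is NOT a discharge of the named fact: it remains conditional on `hχ`, (T2) and (T3).
[cite: Topping2006, §8.3, Thm. 8.3.1, Thm. 8.3.4, Lemma 8.3.5] -/
theorem perelman_noLocalCollapsing_of_cutoffs (C₀ : ℝ)
    (hχ : ∀ {E : Type u} [NormedAddCommGroup E] [NormedSpace ℝ E] [FiniteDimensional ℝ E]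
      {H : Type v} [TopologicalSpace H] (I : ModelWithCorners ℝ E H) [I.Boundaryless]
      (M : Type w) [TopologicalSpace M] [T2Space M] [SecondCountableTopology M] [CompactSpace M]
      [ChartedSpace H M] [IsManifold I ∞ M]
      (g : PseudoRiemannianMetric I ∞ E (TangentSpace I : M → Type _)),
      g.IsRiemannian → ∀ (p : M) (s : ℝ), 0 < s → ∃ χ : M → ℝ,
        ContMDiff I 𝓘(ℝ, ℝ) ∞ χ ∧ (∀ x, 0 ≤ χ x) ∧ (∀ x, χ x ≤ 1) ∧
        (∀ x ∈ g.ball p (ENNReal.ofReal (s / 2)), χ x = 1) ∧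
        tsupport χ ⊆ g.ball p (ENNReal.ofReal s) ∧ ∀ x, g.gradSq χ x ≤ C₀ / s ^ 2)
    (h₂ : ∀ {E : Type u} [NormedAddCommGroup E] [NormedSpace ℝ E] [FiniteDimensional ℝ E]
      {H : Type v} [TopologicalSpace H] (I : ModelWithCorners ℝ E H) [I.Boundaryless]
      (M : Type w) [TopologicalSpace M] [T2Space M] [SecondCountableTopology M] [CompactSpace M]
      [ChartedSpace H M] [IsManifold I ∞ M] [MeasurableSpace M] [BorelSpace M] (T' : ℝ), 0 < T' →
      ∀ (g : ℝ → PseudoRiemannianMetric I ∞ E (TangentSpace I : M → Type _))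
        (cov : ℝ → CovariantDerivative I E (TangentSpace I : M → Type _)),
        IsRicciFlow g cov (Icc 0 T') → (∀ t ∈ Icc 0 T', (g t).IsRiemannian) →
          ∀ τ : ℝ, 0 < τ → (g 0).muEntropy (cov 0) (τ + T') ≤ (g T').muEntropy (cov T') τ)
    (h₃ : ∀ {E : Type u} [NormedAddCommGroup E] [NormedSpace ℝ E] [FiniteDimensional ℝ E]
      {H : Type v} [TopologicalSpace H] (I : ModelWithCorners ℝ E H) [I.Boundaryless]
      (M : Type w) [TopologicalSpace M] [T2Space M] [SecondCountableTopology M] [CompactSpace M]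
      [ChartedSpace H M] [IsManifold I ∞ M] [MeasurableSpace M] [BorelSpace M]
      (g : PseudoRiemannianMetric I ∞ E (TangentSpace I : M → Type _))
      (cov : CovariantDerivative I E (TangentSpace I : M → Type _)),
      g.IsRiemannian → g.IsLeviCivita cov → ∀ τ₀ : ℝ, 0 < τ₀ →
        ∃ m : ℝ, ∀ τ ∈ Ioc 0 τ₀, (m : EReal) ≤ g.muEntropy cov τ) :
    perelman_noLocalCollapsing.{u, v, w} := by
  refine perelman_noLocalCollapsing_of_entropyDichotomy ?_
  intro E _ _ _ H _ I _ M _ _ _ _ _ _ _ _ T hT g cov hflow hRiem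
  haveI : CompleteSpace E := FiniteDimensional.complete ℝ E
  refine entropyDichotomy_of_cutoffs hT hRiem (fun t ht ↦ ?_)
    (fun t ht p s hs ↦ hχ I M (g t) (hRiem t ht) p s hs) ?_ ?_
  · exact (contMDiff_scalarCurvatureWith_holds I M (g t) (cov t) (hflow.isLeviCivita t ht)).continuous
  · intro t₀ ht₀ τ hτ
    have hsub : Icc 0 t₀ ⊆ Ico 0 T := fun t ht ↦ ⟨ht.1, ht.2.trans_lt ht₀.2⟩
    exact h₂ I M t₀ ht₀.1 g cov (hflow.mono hsub) (fun t ht ↦ hRiem t (hsub ht)) τ hτ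
  · have h0 : (0 : ℝ) ∈ Ico 0 T := ⟨le_rfl, hT⟩
    exact h₃ I M (g 0) (cov 0) (hRiem 0 h0) (hflow.isLeviCivita 0 h0)

end Literature.Geometry.Riemannian

end
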